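import Literature.NumberTheory.EllipticCurves.FormalGroupQuasiPeriod
import Literature.NumberTheory.EllipticCurves.FormalGroupQuasiPeriodAdditionIdentityProofs
import Literature.NumberTheory.EllipticCurves.SigmaThetaLeadingCoeffProofs
import Literature.NumberTheory.EllipticCurves.FormalGroupLawChordFormulaProofs
import HarnessLib

/-!
# The pseudo-addition theorem for the quasi-period function `η₀` (Whittaker–Watson §20·41 on the
# formal group of a Weierstrass equation) — proofs

Topic `Literature/NumberTheory/EllipticCurves`; sequel of `FormalGroupQuasiPeriod` (pure proof file:
no definition, no named fact). For a Weierstrass equation `V` over a `ℚ`-algebra `A` which is a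
domain, with `X = z²x(z)`, `F = u +_F v` (chord–tangent law), `η₀ = formalQuasiPeriod` and
`C₀ = η₀(F) - η₀(u) - η₀(v)` (`formalQuasiPeriodCocycle`), `N = X(u)v² - X(v)u²`, `M = X(v)u³ - X(u)v³`:

  **`u·v·N·F·C₀ = u·v·N - (u + v)·N·F - M·F`**      (`formalQuasiPeriodCocycle_mul_eq_of_chord`)

GRANTED the chord formula for `x(u +_F v)` as a formal identity (hypothesis `hchord`, literally the
statement of the tree's `formalXMulSq_formalGroupLaw_chord`, which is proved there for `p`-integral
elliptic equations over `ℤ_p`); whence UNCONDITIONALLY for every Weierstrass equation over `ℤ_p` with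
elliptic generic fibre, read over `ℚ_p` (`formalQuasiPeriodCocycle_mul_eq_padic`). This is the
statement of the named fact `WeierstrassCurve.formalQuasiPeriod_addition` at such `V`; the universal
discharge needs only the universal chord formula.

Method (Blakestad–Grant's `D₁`-Wronskian method, as in `CanonicalPAdicHeightThetaFormalProofs`): with
`Ψ = u v N F·C₀ - (u v N - (u+v) N F - M F)`,
* §1 a generic polynomial identity (`quasiPeriod_wronskian_identity`, pure commutative algebra, the
  cofactors found by elimination): modulo `Dx = 2y + a₁x + a₃`, `η·X = 3X² - …`, the chord formula and
  the two Weierstrass relations, `(uvNF)²·(u²F²·D₁C₀) = u²F²·((uvNF)·D₁N' - N'·D₁(uvNF))` — the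
  pole-cleared form of `D₁(-λ + 1/F - 1/u) = x(u +_F v) - x(u) - η(F)/F² + η(u)/u² = D₁C₀`, i.e. of
  `D₁λ = x₁ - x₃` on `E × E`;
* §2 hence `∂ᵤΨ · (uvNF) = Ψ · ∂ᵤ(uvNF)` (`pderiv_psi_mul_eq`);
* §3 a Wronskian lemma with a simple zero (`eq_zero_of_pderiv_mul_eq_of_X_mul`: `∂h·(uG) = h·∂(uG)`,
  `G(0,v) ≠ 0`, `h(0,v) = ∂ᵤh(0,v) = 0 ⇒ h = 0`), and the expansions `Ψ(0, v) = 0`, `∂ᵤΨ(0, v) = 0`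
  (`F(0,v) = v`, `∂ᵤF(0,v) = η(v)`, `X(0) = 1`, `X'(0) = -a₁`), give `Ψ = 0`.

BSD context: crux K★ `stmt-BirchSwinnertonDyer-22226`, hDR sector (iii) (the `η`-period of the
Weierstrass formal group); BSD is not proved by any of this.

## References
* E. T. Whittaker, G. N. Watson, *A Course of Modern Analysis* (1927), §20·41. [WhittakerWatson1927]
* J. H. Silverman, *The Arithmetic of Elliptic Curves* (2009), III.2.3, IV.1. [SilvermanAEC2009]
* C. Blakestad, D. Grant, J. Number Theory 249 (2023), §3 (the `D₁` method). [BlakestadGrant2023]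
* N. M. Katz, *Crystalline cohomology, Dieudonné modules, and Jacobi sums* (1981), §5.1.
  [Katz1981CrystallineDieudonne]
-/

noncomputable section

open PowerSeries Literature.NumberTheory.EllipticCurves
open Literature.AlgebraicGeometry.Resolution (MvPowerSeries.pderiv MvPowerSeries.pderiv_X
  MvPowerSeries.pderiv_powerSeries_subst MvPowerSeries.pderiv_powerSeries_subst_X)

namespace WeierstrassCurve

/-- `X₀ ≠ 0` in `R⟦u, v⟧`. [folklore] -/
private theorem aux_mvX_zero_ne_zero' {R : Type*} [CommRing R] [Nontrivial R] :
    (MvPowerSeries.X 0 : MvPowerSeries (Fin 2) R) ≠ 0 := by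
  intro h
  have := congrArg (MvPowerSeries.coeff (Finsupp.single (0 : Fin 2) 1)) h
  rw [MvPowerSeries.coeff_X, if_pos rfl, map_zero] at this
  exact one_ne_zero this

/-- A series whose restriction to `u = 0` is nonzero is nonzero. [folklore] -/
private theorem aux_ne_zero_of_subst_zero_X' {R : Type*} [CommRing R] {g : MvPowerSeries (Fin 2) R}
    (hg : MvPowerSeries.subst ![(0 : R⟦X⟧), PowerSeries.X] g ≠ 0) : g ≠ 0 := by
  rintro rfl
  exact hg (by rw [← MvPowerSeries.coe_substAlgHom hasSubst_zero_X, map_zero])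

/-! ### §4 The pseudo-addition theorem granted the chord formula -/

section Main

variable {A : Type*} [CommRing A] [IsDomain A] [Algebra ℚ A] (V : WeierstrassCurve A)

/-- `u v N F · D₁Ψ`-relation: with `M' = uvNF`, `N' = uvN - (u+v)NF - MF`, `Ψ = M'·C₀ - N'`, granted the
chord formula, `∂ᵤΨ·M' = Ψ·∂ᵤM'` (from §1, `u²F²·D₁C₀ = u²(X-η)(F) - F²(X-η)(u)` and `D₁ = η(u)∂ᵤ`,
cancelling the non-zero-divisor `N²u²v²·X(u)·u·u²F²·η(u)`). [cite: BlakestadGrant2023, Prop. 14] -/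
theorem pderiv_quasiPeriodPsi_mul_eq
    (hchord : V.formalXMulSq.subst V.formalGroupLaw *
        (V.formalXMulSq.subst (MvPowerSeries.X 0 : MvPowerSeries (Fin 2) A) * (MvPowerSeries.X 1) ^ 2 -
          V.formalXMulSq.subst (MvPowerSeries.X 1 : MvPowerSeries (Fin 2) A) * (MvPowerSeries.X 0) ^ 2) ^ 2 *
        (MvPowerSeries.X 0) ^ 2 * (MvPowerSeries.X 1) ^ 2 =
      V.formalGroupLaw ^ 2 *
        ((V.formalXMulSq.subst (MvPowerSeries.X 1 : MvPowerSeries (Fin 2) A) * (MvPowerSeries.X 0) ^ 3 -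
              V.formalXMulSq.subst (MvPowerSeries.X 0 : MvPowerSeries (Fin 2) A) * (MvPowerSeries.X 1) ^ 3) ^ 2 +
          MvPowerSeries.C V.a₁ *
            (V.formalXMulSq.subst (MvPowerSeries.X 1 : MvPowerSeries (Fin 2) A) * (MvPowerSeries.X 0) ^ 3 -
              V.formalXMulSq.subst (MvPowerSeries.X 0 : MvPowerSeries (Fin 2) A) * (MvPowerSeries.X 1) ^ 3) *
            (V.formalXMulSq.subst (MvPowerSeries.X 0 : MvPowerSeries (Fin 2) A) * (MvPowerSeries.X 1) ^ 2 -
              V.formalXMulSq.subst (MvPowerSeries.X 1 : MvPowerSeries (Fin 2) A) * (MvPowerSeries.X 0) ^ 2) *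
            MvPowerSeries.X 0 * MvPowerSeries.X 1 -
          (MvPowerSeries.C V.a₂ * (MvPowerSeries.X 0) ^ 2 * (MvPowerSeries.X 1) ^ 2 +
              V.formalXMulSq.subst (MvPowerSeries.X 0 : MvPowerSeries (Fin 2) A) * (MvPowerSeries.X 1) ^ 2 +
              V.formalXMulSq.subst (MvPowerSeries.X 1 : MvPowerSeries (Fin 2) A) * (MvPowerSeries.X 0) ^ 2) *
            (V.formalXMulSq.subst (MvPowerSeries.X 0 : MvPowerSeries (Fin 2) A) * (MvPowerSeries.X 1) ^ 2 -
              V.formalXMulSq.subst (MvPowerSeries.X 1 : MvPowerSeries (Fin 2) A) * (MvPowerSeries.X 0) ^ 2) ^ 2)) :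
    let u : MvPowerSeries (Fin 2) A := MvPowerSeries.X 0
    let v : MvPowerSeries (Fin 2) A := MvPowerSeries.X 1
    let Nt := V.formalXMulSq.subst u * v ^ 2 - V.formalXMulSq.subst v * u ^ 2
    let Mt := V.formalXMulSq.subst v * u ^ 3 - V.formalXMulSq.subst u * v ^ 3
    let M' := u * v * Nt * V.formalGroupLaw
    let Ψ := M' * V.formalQuasiPeriodCocycle - (u * v * Nt - (u + v) * Nt * V.formalGroupLaw - Mt * V.formalGroupLaw)
    MvPowerSeries.pderiv 0 Ψ * M' = Ψ * MvPowerSeries.pderiv 0 M' := by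
  intro u v Nt Mt M' Ψ
  set Xu := V.formalXMulSq.subst u with hXu
  set Xv := V.formalXMulSq.subst v with hXv
  set F := V.formalGroupLaw with hF
  set XF := V.formalXMulSq.subst F with hXF
  set ηu := V.formalEta.subst u with hηu
  set ηF := V.formalEta.subst F with hηF
  set DXu := (V.formalInvariantDerivation V.formalXMulSq).subst u with hDXu
  set D := V.formalInvariantDerivationMv (0 : Fin 2) with hD
  set N' := u * v * Nt - (u + v) * Nt * F - Mt * F with hN'
  -- §1 in `A⟦u, v⟧`
  have key := quasiPeriod_wronskian_identity (MvPowerSeries.C V.a₁) (MvPowerSeries.C V.a₂)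
    (MvPowerSeries.C V.a₃) (MvPowerSeries.C V.a₄) (MvPowerSeries.C V.a₆) u v Xu Xv F XF ηu ηF DXu
    (D M') (D N') (V.subst_X_zero_X_mul_formalInvariantDerivation_formalXMulSq)
    (V.subst_X_zero_formalEta_mul_formalXMulSq) hchord (V.subst_X_formalXMulSq_sq_eq 0)
    (V.subst_X_formalXMulSq_sq_eq 1) (V.formalInvariantDerivationMv_M') (V.formalInvariantDerivationMv_N')
  -- `u²F²·D₁C₀ = u²(XF - ηF) - F²(Xu - ηu)`
  have hC := V.X_sq_mul_formalGroupLaw_sq_mul_formalInvariantDerivationMv_cocycle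
  rw [PowerSeries.subst_sub V.hasSubst_formalGroupLaw,
    PowerSeries.subst_sub (PowerSeries.HasSubst.X 0)] at hC
  -- `D₁Ψ`
  have hDΨ : D Ψ = D M' * V.formalQuasiPeriodCocycle + M' * D V.formalQuasiPeriodCocycle - D N' := by
    simp only [Ψ, hN', map_sub, Derivation.leibniz, smul_eq_mul]
    ring
  -- the Wronskian combination, times the non-zero-divisor
  have hmain : (Nt ^ 2 * u ^ 2 * v ^ 2 * Xu * u) * (u ^ 2 * F ^ 2) * (M' * D Ψ - Ψ * D M') = 0 := by
    have : (u ^ 2 * F ^ 2) * (M' * D Ψ - Ψ * D M') =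
        M' ^ 2 * (u ^ 2 * (XF - ηF) - F ^ 2 * (Xu - ηu)) - u ^ 2 * F ^ 2 * (M' * D N' - N' * D M') := by
      rw [hDΨ]
      linear_combination M' ^ 2 * hC
    rw [mul_assoc, this]
    exact key
  -- non-vanishing of the factors
  have hs := hasSubst_zero_X (R := A)
  have hu : u ≠ 0 := aux_mvX_zero_ne_zero'
  have hv : v ≠ 0 := aux_ne_zero_of_subst_zero_X' (by rw [subst_zero_X_X_one]; exact PowerSeries.X_ne_zero)
  have hXu0 : Xu ≠ 0 := aux_ne_zero_of_subst_zero_X' (by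
    rw [hXu, subst_zero_X_powerSeries_subst_X_zero, constantCoeff_formalXMulSq, map_one]; exact one_ne_zero)
  have hF0 : F ≠ 0 := aux_ne_zero_of_subst_zero_X' (by rw [hF, formalGroupLaw_subst_zero_X]; exact PowerSeries.X_ne_zero)
  have hNt : Nt ≠ 0 := aux_ne_zero_of_subst_zero_X' (by
    show MvPowerSeries.subst ![(0 : A⟦X⟧), PowerSeries.X] (Xu * v ^ 2 - Xv * u ^ 2) ≠ 0
    rw [MvPowerSeries.subst_sub hs, MvPowerSeries.subst_mul hs, MvPowerSeries.subst_mul hs,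
      MvPowerSeries.subst_pow hs, MvPowerSeries.subst_pow hs, hXu, hXv, subst_zero_X_powerSeries_subst_X_zero,
      subst_zero_X_powerSeries_subst_X_one, subst_zero_X_X_zero, subst_zero_X_X_one,
      constantCoeff_formalXMulSq, map_one, one_mul, zero_pow two_ne_zero, mul_zero, sub_zero]
    exact pow_ne_zero 2 PowerSeries.X_ne_zero)
  have hηu0 : ηu ≠ 0 := aux_ne_zero_of_subst_zero_X' (by
    rw [hηu, subst_zero_X_powerSeries_subst_X_zero, constantCoeff_formalEta, map_one]; exact one_ne_zero)
  have hL : (Nt ^ 2 * u ^ 2 * v ^ 2 * Xu * u) * (u ^ 2 * F ^ 2) ≠ 0 := by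
    refine mul_ne_zero (mul_ne_zero (mul_ne_zero (mul_ne_zero (mul_ne_zero (pow_ne_zero 2 hNt)
      (pow_ne_zero 2 hu)) (pow_ne_zero 2 hv)) hXu0) hu) (mul_ne_zero (pow_ne_zero 2 hu) (pow_ne_zero 2 hF0))
  have hW : M' * D Ψ - Ψ * D M' = 0 := (mul_eq_zero.mp hmain).resolve_left hL
  -- `D₁ = η(u)·∂ᵤ`
  rw [hD, formalInvariantDerivationMv_apply, formalInvariantDerivationMv_apply, ← hηu] at hW
  have hW' : ηu * (MvPowerSeries.pderiv 0 Ψ * M' - Ψ * MvPowerSeries.pderiv 0 M') = 0 := by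
    linear_combination hW
  exact sub_eq_zero.mp ((mul_eq_zero.mp hW').resolve_left hηu0)

end Main


/-! ### §5 `Ψ(0, v) = 0`, `∂ᵤΨ(0, v) = 0`, and the theorem -/

section Final

variable {A : Type*} [CommRing A] [IsDomain A] [Algebra ℚ A] (V : WeierstrassCurve A)

/-- **The pseudo-addition theorem for `η₀`, granted the chord formula for `x(u +_F v)`** (hypothesis
`hchord`, literally the tree's `formalXMulSq_formalGroupLaw_chord`): in `A⟦u, v⟧`,
`u·v·N·F·C₀ = u·v·N - (u + v)·N·F - M·F` with `N = X(u)v² - X(v)u²`, `M = X(v)u³ - X(u)v³`,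
`C₀ = η₀(u +_F v) - η₀(u) - η₀(v)` — i.e. `η₀(u +_F v) - η₀(u) - η₀(v) = -(y₁ - y₂)/(x₁ - x₂) + 1/F - 1/u - 1/v`
(Whittaker–Watson §20·41 for the formal group). [cite: WhittakerWatson1927, §20.41] -/
theorem formalQuasiPeriodCocycle_mul_eq_of_chord
    (hchord : V.formalXMulSq.subst V.formalGroupLaw *
        (V.formalXMulSq.subst (MvPowerSeries.X 0 : MvPowerSeries (Fin 2) A) * (MvPowerSeries.X 1) ^ 2 -
          V.formalXMulSq.subst (MvPowerSeries.X 1 : MvPowerSeries (Fin 2) A) * (MvPowerSeries.X 0) ^ 2) ^ 2 *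
        (MvPowerSeries.X 0) ^ 2 * (MvPowerSeries.X 1) ^ 2 =
      V.formalGroupLaw ^ 2 *
        ((V.formalXMulSq.subst (MvPowerSeries.X 1 : MvPowerSeries (Fin 2) A) * (MvPowerSeries.X 0) ^ 3 -
              V.formalXMulSq.subst (MvPowerSeries.X 0 : MvPowerSeries (Fin 2) A) * (MvPowerSeries.X 1) ^ 3) ^ 2 +
          MvPowerSeries.C V.a₁ *
            (V.formalXMulSq.subst (MvPowerSeries.X 1 : MvPowerSeries (Fin 2) A) * (MvPowerSeries.X 0) ^ 3 -
              V.formalXMulSq.subst (MvPowerSeries.X 0 : MvPowerSeries (Fin 2) A) * (MvPowerSeries.X 1) ^ 3) *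
            (V.formalXMulSq.subst (MvPowerSeries.X 0 : MvPowerSeries (Fin 2) A) * (MvPowerSeries.X 1) ^ 2 -
              V.formalXMulSq.subst (MvPowerSeries.X 1 : MvPowerSeries (Fin 2) A) * (MvPowerSeries.X 0) ^ 2) *
            MvPowerSeries.X 0 * MvPowerSeries.X 1 -
          (MvPowerSeries.C V.a₂ * (MvPowerSeries.X 0) ^ 2 * (MvPowerSeries.X 1) ^ 2 +
              V.formalXMulSq.subst (MvPowerSeries.X 0 : MvPowerSeries (Fin 2) A) * (MvPowerSeries.X 1) ^ 2 +
              V.formalXMulSq.subst (MvPowerSeries.X 1 : MvPowerSeries (Fin 2) A) * (MvPowerSeries.X 0) ^ 2) *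
            (V.formalXMulSq.subst (MvPowerSeries.X 0 : MvPowerSeries (Fin 2) A) * (MvPowerSeries.X 1) ^ 2 -
              V.formalXMulSq.subst (MvPowerSeries.X 1 : MvPowerSeries (Fin 2) A) * (MvPowerSeries.X 0) ^ 2) ^ 2)) :
    (MvPowerSeries.X 0 : MvPowerSeries (Fin 2) A) * MvPowerSeries.X 1 *
        (V.formalXMulSq.subst (MvPowerSeries.X 0 : MvPowerSeries (Fin 2) A) * (MvPowerSeries.X 1) ^ 2 - V.formalXMulSq.subst (MvPowerSeries.X 1 : MvPowerSeries (Fin 2) A) * (MvPowerSeries.X 0) ^ 2) *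
        V.formalGroupLaw * V.formalQuasiPeriodCocycle =
      (MvPowerSeries.X 0 : MvPowerSeries (Fin 2) A) * MvPowerSeries.X 1 *
          (V.formalXMulSq.subst (MvPowerSeries.X 0 : MvPowerSeries (Fin 2) A) * (MvPowerSeries.X 1) ^ 2 - V.formalXMulSq.subst (MvPowerSeries.X 1 : MvPowerSeries (Fin 2) A) * (MvPowerSeries.X 0) ^ 2) -
        (MvPowerSeries.X 0 + MvPowerSeries.X 1) *
          (V.formalXMulSq.subst (MvPowerSeries.X 0 : MvPowerSeries (Fin 2) A) * (MvPowerSeries.X 1) ^ 2 - V.formalXMulSq.subst (MvPowerSeries.X 1 : MvPowerSeries (Fin 2) A) * (MvPowerSeries.X 0) ^ 2) * V.formalGroupLaw -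
        (V.formalXMulSq.subst (MvPowerSeries.X 1 : MvPowerSeries (Fin 2) A) * (MvPowerSeries.X 0) ^ 3 - V.formalXMulSq.subst (MvPowerSeries.X 0 : MvPowerSeries (Fin 2) A) * (MvPowerSeries.X 1) ^ 3) * V.formalGroupLaw := by
  haveI : CharZero A := charZero_of_injective_algebraMap (algebraMap ℚ A).injective
  have hs := hasSubst_zero_X (R := A)
  have hrel := V.pderiv_quasiPeriodPsi_mul_eq hchord
  simp only at hrel
  -- values at `u = 0`
  have hXu0 : MvPowerSeries.subst ![(0 : A⟦X⟧), PowerSeries.X] (V.formalXMulSq.subst (MvPowerSeries.X 0 : MvPowerSeries (Fin 2) A)) = 1 := by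
    rw [subst_zero_X_powerSeries_subst_X_zero, constantCoeff_formalXMulSq, map_one]
  have hXv0 : MvPowerSeries.subst ![(0 : A⟦X⟧), PowerSeries.X] (V.formalXMulSq.subst (MvPowerSeries.X 1 : MvPowerSeries (Fin 2) A)) = V.formalXMulSq :=
    subst_zero_X_powerSeries_subst_X_one _
  have hC0 : MvPowerSeries.subst ![(0 : A⟦X⟧), PowerSeries.X] V.formalQuasiPeriodCocycle = 0 := by
    rw [formalQuasiPeriodCocycle_def, MvPowerSeries.subst_sub hs, MvPowerSeries.subst_sub hs,
      V.subst_zero_X_subst_formalGroupLaw, subst_zero_X_powerSeries_subst_X_zero,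
      subst_zero_X_powerSeries_subst_X_one, constantCoeff_formalQuasiPeriod, map_zero, sub_zero, sub_self]
  have hX' : MvPowerSeries.subst ![(0 : A⟦X⟧), PowerSeries.X]
      ((d⁄dX A V.formalXMulSq).subst (MvPowerSeries.X 0 : MvPowerSeries (Fin 2) A)) = -PowerSeries.C V.a₁ := by
    rw [subst_zero_X_powerSeries_subst_X_zero, ← coeff_zero_eq_constantCoeff_apply, coeff_derivative,
      zero_add, coeff_one_formalXMulSq, Nat.cast_zero, zero_add, mul_one, map_neg]
  refine sub_eq_zero.mp (eq_zero_of_pderiv_mul_eq_of_X_mul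
    (G := (MvPowerSeries.X 1 : MvPowerSeries (Fin 2) A) * (V.formalXMulSq.subst (MvPowerSeries.X 0 : MvPowerSeries (Fin 2) A) * (MvPowerSeries.X 1) ^ 2 - V.formalXMulSq.subst (MvPowerSeries.X 1 : MvPowerSeries (Fin 2) A) * (MvPowerSeries.X 0) ^ 2) * V.formalGroupLaw) ?_ ?_ ?_ ?_)
  · -- the Wronskian relation
    have hM : (MvPowerSeries.X 0 : MvPowerSeries (Fin 2) A) * MvPowerSeries.X 1 * (V.formalXMulSq.subst (MvPowerSeries.X 0 : MvPowerSeries (Fin 2) A) * (MvPowerSeries.X 1) ^ 2 - V.formalXMulSq.subst (MvPowerSeries.X 1 : MvPowerSeries (Fin 2) A) * (MvPowerSeries.X 0) ^ 2) * V.formalGroupLaw =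
        (MvPowerSeries.X 0 : MvPowerSeries (Fin 2) A) * ((MvPowerSeries.X 1 : MvPowerSeries (Fin 2) A) * (V.formalXMulSq.subst (MvPowerSeries.X 0 : MvPowerSeries (Fin 2) A) * (MvPowerSeries.X 1) ^ 2 - V.formalXMulSq.subst (MvPowerSeries.X 1 : MvPowerSeries (Fin 2) A) * (MvPowerSeries.X 0) ^ 2) * V.formalGroupLaw) := by ring
    rw [← hM]
    exact hrel
  · -- `G(0, v) = v⁴ ≠ 0`
    rw [MvPowerSeries.subst_mul hs, MvPowerSeries.subst_mul hs, MvPowerSeries.subst_sub hs,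
      MvPowerSeries.subst_mul hs, MvPowerSeries.subst_mul hs, MvPowerSeries.subst_pow hs,
      MvPowerSeries.subst_pow hs, hXu0, hXv0, subst_zero_X_X_zero, subst_zero_X_X_one,
      V.formalGroupLaw_subst_zero_X]
    ring_nf
    exact pow_ne_zero 4 PowerSeries.X_ne_zero
  · -- `Ψ(0, v) = 0`
    simp only [MvPowerSeries.subst_sub hs, MvPowerSeries.subst_mul hs, MvPowerSeries.subst_add hs,
      MvPowerSeries.subst_pow hs, hXu0, hXv0, hC0, subst_zero_X_X_zero, subst_zero_X_X_one,
      V.formalGroupLaw_subst_zero_X]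
    ring
  · -- `∂ᵤΨ(0, v) = 0`
    have hdXu : MvPowerSeries.pderiv 0 (V.formalXMulSq.subst (MvPowerSeries.X 0 : MvPowerSeries (Fin 2) A)) =
        (d⁄dX A V.formalXMulSq).subst (MvPowerSeries.X 0 : MvPowerSeries (Fin 2) A) := by
      rw [MvPowerSeries.pderiv_powerSeries_subst_X, if_pos rfl]
    have hdXv : MvPowerSeries.pderiv 0 (V.formalXMulSq.subst (MvPowerSeries.X 1 : MvPowerSeries (Fin 2) A)) = 0 := by
      rw [MvPowerSeries.pderiv_powerSeries_subst_X, if_neg (by decide)]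
    have hdu : MvPowerSeries.pderiv 0 (MvPowerSeries.X 0 : MvPowerSeries (Fin 2) A) = 1 := by
      rw [MvPowerSeries.pderiv_X, if_pos rfl]
    have hdv : MvPowerSeries.pderiv 0 (MvPowerSeries.X 1 : MvPowerSeries (Fin 2) A) = 0 := by
      rw [MvPowerSeries.pderiv_X, if_neg (by decide)]
    have h0 : MvPowerSeries.subst ![(0 : A⟦X⟧), PowerSeries.X] (0 : MvPowerSeries (Fin 2) A) = 0 := by
      rw [← MvPowerSeries.coe_substAlgHom hs, map_zero]
    have h1 : MvPowerSeries.subst ![(0 : A⟦X⟧), PowerSeries.X] (1 : MvPowerSeries (Fin 2) A) = 1 := by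
      rw [← MvPowerSeries.coe_substAlgHom hs, map_one]
    have h2 : MvPowerSeries.subst ![(0 : A⟦X⟧), PowerSeries.X] (2 : MvPowerSeries (Fin 2) A) = 2 := by
      rw [← MvPowerSeries.coe_substAlgHom hs, map_ofNat]
    have h3 : MvPowerSeries.subst ![(0 : A⟦X⟧), PowerSeries.X] (3 : MvPowerSeries (Fin 2) A) = 3 := by
      rw [← MvPowerSeries.coe_substAlgHom hs, map_ofNat]
    have hF0 := V.formalGroupLaw_subst_zero_X
    have hFu := V.subst_zero_X_pderiv_formalGroupLaw
    simp only [Derivation.leibniz, Derivation.leibniz_pow, map_sub, map_add, smul_eq_mul, nsmul_eq_mul,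
      Nat.cast_ofNat, hdu, hdv, hdXu, hdXv, MvPowerSeries.subst_sub hs, MvPowerSeries.subst_mul hs,
      MvPowerSeries.subst_add hs, MvPowerSeries.subst_pow hs, hXu0, hXv0, hX', hC0, h0, h1, h2, h3,
      subst_zero_X_X_zero, subst_zero_X_X_one, hF0, hFu]
    ring

/-! ### §6 Unconditionally over `ℚ_p` -/

end Final

section Padic

variable {p : ℕ} [Fact p.Prime] (V : WeierstrassCurve ℤ_[p]) [hE : (V.map PadicInt.Coe.ringHom).IsElliptic]

/-- **The pseudo-addition theorem for `η₀`, unconditionally, for every Weierstrass equation over `ℤ_p`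
with elliptic generic fibre** (read over `ℚ_p`): the chord formula is the tree theorem
`formalXMulSq_formalGroupLaw_chord`. [cite: WhittakerWatson1927, §20.41] -/
theorem formalQuasiPeriodCocycle_mul_eq_padic :
    let V' := V.map PadicInt.Coe.ringHom
    (MvPowerSeries.X 0 : MvPowerSeries (Fin 2) ℚ_[p]) * MvPowerSeries.X 1 *
        (V'.formalXMulSq.subst (MvPowerSeries.X 0 : MvPowerSeries (Fin 2) ℚ_[p]) * (MvPowerSeries.X 1) ^ 2 -
          V'.formalXMulSq.subst (MvPowerSeries.X 1 : MvPowerSeries (Fin 2) ℚ_[p]) * (MvPowerSeries.X 0) ^ 2) *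
        V'.formalGroupLaw * V'.formalQuasiPeriodCocycle =
      (MvPowerSeries.X 0 : MvPowerSeries (Fin 2) ℚ_[p]) * MvPowerSeries.X 1 *
          (V'.formalXMulSq.subst (MvPowerSeries.X 0 : MvPowerSeries (Fin 2) ℚ_[p]) * (MvPowerSeries.X 1) ^ 2 -
            V'.formalXMulSq.subst (MvPowerSeries.X 1 : MvPowerSeries (Fin 2) ℚ_[p]) * (MvPowerSeries.X 0) ^ 2) -
        (MvPowerSeries.X 0 + MvPowerSeries.X 1) *
          (V'.formalXMulSq.subst (MvPowerSeries.X 0 : MvPowerSeries (Fin 2) ℚ_[p]) * (MvPowerSeries.X 1) ^ 2 -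
            V'.formalXMulSq.subst (MvPowerSeries.X 1 : MvPowerSeries (Fin 2) ℚ_[p]) * (MvPowerSeries.X 0) ^ 2) *
          V'.formalGroupLaw -
        (V'.formalXMulSq.subst (MvPowerSeries.X 1 : MvPowerSeries (Fin 2) ℚ_[p]) * (MvPowerSeries.X 0) ^ 3 -
            V'.formalXMulSq.subst (MvPowerSeries.X 0 : MvPowerSeries (Fin 2) ℚ_[p]) * (MvPowerSeries.X 1) ^ 3) *
          V'.formalGroupLaw := by
  intro V'
  have h := congrArg (MvPowerSeries.map (σ := Fin 2) PadicInt.Coe.ringHom) V.formalXMulSq_formalGroupLaw_chord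
  simp only [map_mul, map_pow, map_add, map_sub, MvPowerSeries.map_X, MvPowerSeries.map_C,
    PowerSeries.map_subst (PowerSeries.HasSubst.X _), PowerSeries.map_subst V.hasSubst_formalGroupLaw,
    map_formalXMulSq, map_formalGroupLaw] at h
  exact V'.formalQuasiPeriodCocycle_mul_eq_of_chord h

end Padic

end WeierstrassCurve
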